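/-
Copyright (c) 2026 the pub-hodgecm-mathlib formalisation cell (harness21).  Prover seat hodgecm-mathlib-LH4-p08 (g11) (valve hand), Track B «K2-LIT»,
#184♮ = hLiu418 = `stmt-HodgeConjecture-24832`; socket #41, KIND W, (x-b) side — KIND-W byte desk K2E4-p10 (g9) 2026-09-04T22:53:23Z (A) under LEAD F0P6-plan (g14)
BATCH #109 (4): «THE G7 BLOCK DECOMPOSITION AT THE POINT».
THEOREMS ONLY (no `def`, no `instance`, no notation, no named-fact hypothesis, no `sorry`).
-/
import Summits.HodgeConjecture.HodgeConjecture.Theorems.K2LiuArchBlockHeightBound     -- ★ G7-B: the frame letters `archAt`, `archPart`, `adelicGroupData` (through its imports)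
import Mathlib.Analysis.InnerProductSpace.PiL2
import Mathlib.Analysis.CStarAlgebra.Matrix
import HarnessLib

/-!
# Crux `HLiu418`, socket #41, KIND W — `K2LiuSiegelEisensteinKindWBlockAtPoint`: THE G7 BLOCK DECOMPOSITION AT THE POINT

Cell `hodgecm-mathlib`, crux item hLiu418 = `stmt-HodgeConjecture-24832` (helper lane `--supports … --as helper`, count-neutral), route of record `HCCMUnconditional`;
squad K2 ∕ K2Liu, road `K2_Liu`, socket #41 `sig_K2LiuSiegelEisensteinContinuation`, KIND W.
★ G7-C `K2LiuIwasawaHeightLatticeSumBound.{latticeSum_le_height, detFactor_le_height}`, ★ `K2LiuSiegelEisensteinKindWArchDecay.decay_le_exp_neg_height` and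
★ `K2LiuSiegelEisensteinKindWArchBlock.archGrowth_le_heightDecay` all take, BY VALUE, a block decomposition
`T σ · (h_∞)~_{w σ} · T σ⁻¹ = [y σ, b σ; 0, d σ] · κ σ` with movers `κ σ κ′ σ = 1 = κ′ σ κ σ` of entries `≤ M`; no ★ file produced one at an actual `h`.
THIS FILE does:
* §1 (pure matrix algebra over `ℂ`, the Iwasawa ∕ QR step IN BLOCKS) **`exists_blockUpper_mul_unitary`**: every invertible `g ∈ M_{p ⊕ p}(ℂ)` is `g = P · κ` with
  `P₂₁ = 0` and `κ` UNITARY — the columns of `κᴴ` indexed by `inl` are an orthonormal basis of `W = g⁻¹(ℂ^p ⊕ 0)` (`finrank W = |p|` by rank–nullity on the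
  onto map `v ↦ (g v)|_{inr}`), those indexed by `inr` an orthonormal basis of `Wᗮ` (Mathlib `stdOrthonormalBasis`, `Submodule.finrank_add_finrank_orthogonal`,
  `OrthonormalBasis.mk`, `OrthonormalBasis.toMatrix_orthonormalBasis_mem_unitary`); **`exists_fromBlocks_mul`**: the same in the ★ G7 currency
  `g = [y b; 0 d] · κ`, `κ κ′ = 1 = κ′ κ`, all entries of `κ, κ′` of norm `≤ 1` (Mathlib `entry_norm_bound_of_unitary`);
* §2 **`exists_blockDecomposition_archAt`** — at the point `h ∈ U(J)(𝔸_F)`, for ANY frames `T σ, T σ⁻¹` with `T σ · T σ⁻¹ = 1`, any `r : p ⊕ p ≃ Fin N` and any bound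
  `M ≥ 1`: `∃ y b d κ κ′` with `κ σ κ′ σ = 1`, `κ′ σ κ σ = 1`, entries `≤ M`, and the ★ G7 `hdec` bytes verbatim
  `T σ * reindex r.symm r.symm ((h_∞)_{w σ}) * Tinv σ = fromBlocks (y σ) (b σ) 0 (d σ) * κ σ` (the conjugated point is invertible: `T σ`, `T σ⁻¹` by
  `Matrix.isUnit_det_of_{right,left}_inverse`, the reindexed `U(J)`-component by `Matrix.det_reindex_self` + `Matrix.isUnits_det_units`).
[BorelJacquet1979, §1.2, §4.1] [MoeglinWaldspurger1995, I.2.2] [Shimura1997, §A3].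
HONEST LABEL.  Count-neutral helper, closes no socket: `HC_CM` is proved only modulo the 7 printed citations (2 remaining named inputs: hLiu418 =
`stmt-HodgeConjecture-24832`, h413 = `stmt-HodgeConjecture-24833`) until rung 0 closes.
-/

set_option autoImplicit false
set_option linter.dupNamespace false -- the mandated namespace repeats `HodgeConjecture.HodgeConjecture`

noncomputable section

open scoped BigOperators ComplexOrder Matrix
-- `Classical` is needed to see the Mathlib normed-ring instances on `mixedSpace E` (note H5 of `AdelicGLnGlue`)
open scoped Classical
open Finset

namespace Summit.HodgeConjecture.HodgeConjecture.Cruxes.HLiu418.K2LiuSiegelEisensteinKindWBlockAtPoint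

/-! ## §1 Block-upper-triangular × unitary (the Iwasawa ∕ QR step, in blocks) -/

section QR

variable {p : Type*} [Fintype p] [DecidableEq p]

/-- **BLOCK QR**: every invertible `g ∈ M_{p ⊕ p}(ℂ)` is `P · κ` with `P₂₁ = 0` and `κ` unitary. [folklore] [cite: BorelJacquet1979, §1.2] -/
theorem exists_blockUpper_mul_unitary (g : Matrix (p ⊕ p) (p ⊕ p) ℂ) (hg : IsUnit g) :
    ∃ (P κ : Matrix (p ⊕ p) (p ⊕ p) ℂ), κ ∈ Matrix.unitaryGroup (p ⊕ p) ℂ ∧ P.toBlocks₂₁ = 0 ∧ g = P * κ := by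
  -- a two-sided inverse of `g`
  have hgd : IsUnit g.det := (Matrix.isUnit_iff_isUnit_det g).1 hg
  have hgg : g * g⁻¹ = 1 := Matrix.mul_nonsing_inv g hgd
  -- the ambient Euclidean space, `g` as a linear map, the lower-coordinate projection and `W = g⁻¹(upper)`
  let L : EuclideanSpace ℂ (p ⊕ p) →ₗ[ℂ] EuclideanSpace ℂ (p ⊕ p) := Matrix.toEuclideanLin g
  let π₂ : EuclideanSpace ℂ (p ⊕ p) →ₗ[ℂ] (p → ℂ) :=
    (LinearMap.funLeft ℂ ℂ (Sum.inr : p → p ⊕ p)) ∘ₗ (WithLp.linearEquiv 2 ℂ ((p ⊕ p) → ℂ)).toLinearMap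
  let W : Submodule ℂ (EuclideanSpace ℂ (p ⊕ p)) := LinearMap.ker (π₂ ∘ₗ L)
  have hπL : ∀ v : EuclideanSpace ℂ (p ⊕ p), ∀ i, (π₂ ∘ₗ L) v i = (g *ᵥ (WithLp.ofLp v)) (Sum.inr i) := fun v i => rfl
  -- `π₂ ∘ g` is onto, so `finrank W = |p|` and `finrank Wᗮ = |p|`
  have hsurj : Function.Surjective (π₂ ∘ₗ L) := by
    intro t
    refine ⟨WithLp.toLp 2 (g⁻¹ *ᵥ Sum.elim 0 t), ?_⟩
    funext i
    rw [hπL, WithLp.ofLp_toLp, Matrix.mulVec_mulVec, hgg, Matrix.one_mulVec, Sum.elim_inr]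
  have hV : Module.finrank ℂ (EuclideanSpace ℂ (p ⊕ p)) = Fintype.card p + Fintype.card p := by
    rw [finrank_euclideanSpace, Fintype.card_sum]
  have hW : Module.finrank ℂ W = Fintype.card p := by
    have h1 : Module.finrank ℂ (LinearMap.range (π₂ ∘ₗ L)) + Module.finrank ℂ W = Module.finrank ℂ (EuclideanSpace ℂ (p ⊕ p)) :=
      LinearMap.finrank_range_add_finrank_ker (π₂ ∘ₗ L)
    rw [LinearMap.range_eq_top.2 hsurj, finrank_top, Module.finrank_fintype_fun_eq_card, hV] at h1
    omega
  have hWo : Module.finrank ℂ Wᗮ = Fintype.card p := by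
    have h2 := Submodule.finrank_add_finrank_orthogonal W
    rw [hW, hV] at h2
    omega
  -- orthonormal bases of `W` and `Wᗮ`, indexed by `p`, concatenated
  let bW : OrthonormalBasis p ℂ W := (stdOrthonormalBasis ℂ W).reindex ((finCongr hW).trans (Fintype.equivFin p).symm)
  let bWo : OrthonormalBasis p ℂ Wᗮ := (stdOrthonormalBasis ℂ Wᗮ).reindex ((finCongr hWo).trans (Fintype.equivFin p).symm)
  let col : p ⊕ p → EuclideanSpace ℂ (p ⊕ p) := Sum.elim (fun i => (bW i : EuclideanSpace ℂ (p ⊕ p))) (fun i => (bWo i : EuclideanSpace ℂ (p ⊕ p)))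
  have hon : Orthonormal ℂ col := by
    rw [orthonormal_iff_ite]
    have h11 := orthonormal_iff_ite.1 bW.orthonormal
    have h22 := orthonormal_iff_ite.1 bWo.orthonormal
    rintro (i | i) (j | j)
    · simp only [col, Sum.elim_inl, Sum.inl.injEq, ← Submodule.coe_inner, h11]
    · simp only [col, Sum.elim_inl, Sum.elim_inr, reduceCtorEq, if_false]
      exact Submodule.inner_right_of_mem_orthogonal (bW i).2 (bWo j).2
    · simp only [col, Sum.elim_inl, Sum.elim_inr, reduceCtorEq, if_false]
      exact Submodule.inner_left_of_mem_orthogonal (bW j).2 (bWo i).2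
    · simp only [col, Sum.elim_inr, Sum.inr.injEq, ← Submodule.coe_inner, h22]
  have hsp : ⊤ ≤ Submodule.span ℂ (Set.range col) :=
    (hon.linearIndependent.span_eq_top_of_card_eq_finrank' (by rw [finrank_euclideanSpace])).ge
  let ob : OrthonormalBasis (p ⊕ p) ℂ (EuclideanSpace ℂ (p ⊕ p)) := OrthonormalBasis.mk hon hsp
  -- the unitary `κ′` whose columns are `col`
  let κ' : Matrix (p ⊕ p) (p ⊕ p) ℂ := (EuclideanSpace.basisFun (p ⊕ p) ℂ).toBasis.toMatrix ob
  have hκ'u : κ' ∈ Matrix.unitaryGroup (p ⊕ p) ℂ :=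
    OrthonormalBasis.toMatrix_orthonormalBasis_mem_unitary (EuclideanSpace.basisFun (p ⊕ p) ℂ) ob
  have hκ'e : ∀ k a, κ' k a = (col a) k := fun k a => by
    simp only [κ', Module.Basis.toMatrix_apply, OrthonormalBasis.coe_toBasis_repr_apply, EuclideanSpace.basisFun_repr, ob, OrthonormalBasis.coe_mk]
  refine ⟨g * κ', star κ', Unitary.star_mem hκ'u, ?_, ?_⟩
  · -- the lower-left block of `g κ′` vanishes: its columns `inl j` are `g (bW j) ∈ upper`
    ext i j
    have hmem : (π₂ ∘ₗ L) (col (Sum.inl j)) = 0 := LinearMap.mem_ker.1 (bW j).2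
    have hi := congr_fun hmem i
    rw [hπL] at hi
    simp only [Matrix.toBlocks₂₁, Matrix.of_apply, Matrix.zero_apply, Matrix.mul_apply, hκ'e]
    simpa only [Matrix.mulVec, dotProduct, Pi.zero_apply] using hi
  · rw [Matrix.mul_assoc, Unitary.mul_star_self_of_mem hκ'u, Matrix.mul_one]

/-- **BLOCK QR in the ★ G7 currency**: `g = [y b; 0 d] · κ`, `κ κ′ = 1 = κ′ κ`, all entries of `κ, κ′` of norm `≤ 1`. [folklore] [cite: BorelJacquet1979, §1.2] -/
theorem exists_fromBlocks_mul (g : Matrix (p ⊕ p) (p ⊕ p) ℂ) (hg : IsUnit g) :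
    ∃ (y b d : Matrix p p ℂ) (κ κ' : Matrix (p ⊕ p) (p ⊕ p) ℂ), κ * κ' = 1 ∧ κ' * κ = 1 ∧ (∀ i j, ‖κ i j‖ ≤ 1) ∧ (∀ i j, ‖κ' i j‖ ≤ 1) ∧
      g = Matrix.fromBlocks y b 0 d * κ := by
  obtain ⟨P, κ, hκ, h21, hg'⟩ := exists_blockUpper_mul_unitary g hg
  have hP : Matrix.fromBlocks P.toBlocks₁₁ P.toBlocks₁₂ 0 P.toBlocks₂₂ = P := by
    rw [← h21]
    exact Matrix.fromBlocks_toBlocks P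
  refine ⟨P.toBlocks₁₁, P.toBlocks₁₂, P.toBlocks₂₂, κ, star κ, Unitary.mul_star_self_of_mem hκ, Unitary.star_mul_self_of_mem hκ,
    entry_norm_bound_of_unitary hκ, entry_norm_bound_of_unitary (Unitary.star_mem hκ), ?_⟩
  rw [hP]
  exact hg'

end QR

/-! ## §2 The block decomposition at the point -/

section Point

open NumberField NumberField.mixedEmbedding NumberField.InfinitePlace IsDedekindDomain
open Literature.NumberTheory.Automorphic Literature.NumberTheory.Automorphic.UnitaryGroup

variable (F E : Type) [Field F] [NumberField F] [Field E] [NumberField E] [Algebra F E] (c : E ≃ₐ[F] E) (N : ℕ) (J : Matrix (Fin N) (Fin N) E)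
variable {S p : Type*} [Fintype p] [DecidableEq p]

/-- **THE G7 BLOCK DECOMPOSITION AT THE POINT.**  For ANY frames `T σ, T σ⁻¹` with `T σ · T σ⁻¹ = 1` (so both are invertible), any bound `M ≥ 1` and every `h ∈ U(J)(𝔸_F)`:
movers `κ σ, κ′ σ` (unitary: entries `≤ 1 ≤ M`) and blocks `y σ, b σ, d σ` with the ★ G7 `hdec` bytes
`T σ * reindex r.symm r.symm ((h_∞)_{w σ}) * Tinv σ = fromBlocks (y σ) (b σ) 0 (d σ) * κ σ` — the by-value input of ★ `latticeSum_le_height`,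
★ `detFactor_le_height`, ★ `decay_le_exp_neg_height(_of_le)`, ★ `archGrowth_le_heightDecay`. [cite: BorelJacquet1979, §1.2, §4.1] [cite: MoeglinWaldspurger1995, I.2.2] -/
theorem exists_blockDecomposition_archAt [NeZero N] (hc : c ≠ 1) (w : S → {w : InfinitePlace E // IsComplex w}) (hw : ∀ σ, c • (w σ).1 = (w σ).1)
    (r : p ⊕ p ≃ Fin N) (T Tinv : S → Matrix (p ⊕ p) (p ⊕ p) ℂ) (hT : ∀ σ, T σ * Tinv σ = 1)
    {M : ℝ} (hM : 1 ≤ M) (h : (adelicGroupData F E c N J).Adelic) :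
    ∃ (y b d : S → Matrix p p ℂ) (κ κ' : S → Matrix (p ⊕ p) (p ⊕ p) ℂ),
      (∀ σ, κ σ * κ' σ = 1) ∧ (∀ σ, κ' σ * κ σ = 1) ∧ (∀ σ i j, ‖κ σ i j‖ ≤ M) ∧ (∀ σ i j, ‖κ' σ i j‖ ≤ M) ∧
      ∀ σ, T σ * Matrix.reindex r.symm r.symm
          ((((archAt F E c N J (w σ) (hw σ) hc (archPart F E c N J h) : archLocal E N J (w σ)) : GL (Fin N) ℂ) : Matrix (Fin N) (Fin N) ℂ)) *
          Tinv σ = Matrix.fromBlocks (y σ) (b σ) 0 (d σ) * κ σ := by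
  -- the conjugated point `g′ σ = T σ · (h_∞)~_{w σ} · T σ⁻¹` is invertible
  have hunit : ∀ σ, IsUnit (T σ * Matrix.reindex r.symm r.symm
      ((((archAt F E c N J (w σ) (hw σ) hc (archPart F E c N J h) : archLocal E N J (w σ)) : GL (Fin N) ℂ) : Matrix (Fin N) (Fin N) ℂ)) * Tinv σ) := by
    intro σ
    refine ((?_ : IsUnit (T σ)).mul ?_).mul ?_
    · exact (Matrix.isUnit_iff_isUnit_det _).2 (Matrix.isUnit_det_of_right_inverse (hT σ))
    · rw [Matrix.isUnit_iff_isUnit_det, Matrix.det_reindex_self]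
      exact Matrix.isUnits_det_units _
    · exact (Matrix.isUnit_iff_isUnit_det _).2 (Matrix.isUnit_det_of_left_inverse (hT σ))
  choose y b d κ κ' hκ hκ' hκe hκe' hdec using fun σ => exists_fromBlocks_mul _ (hunit σ)
  exact ⟨y, b, d, κ, κ', hκ, hκ', fun σ i j => (hκe σ i j).trans hM, fun σ i j => (hκe' σ i j).trans hM, hdec⟩

end Point

end Summit.HodgeConjecture.HodgeConjecture.Cruxes.HLiu418.K2LiuSiegelEisensteinKindWBlockAtPoint

end
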